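import Literature.MathematicalPhysics.QuantumFieldTheory.Balaban1983to89.B9Eq3126KFloorSlotDiagonal
import Literature.MathematicalPhysics.QuantumFieldTheory.Balaban1983to89.B9Eq3126H1BoundTowerVariational

/-!
# `Balaban1983to89.B9Eq3126KFloorSlotDiagonalClosed` — T. Bałaban, *Propagators for lattice gauge theories in a background field*, Commun. Math. Phys. **99**
# (1985) 389–434 [Balaban1985BackgroundPropagators] (3.126) p. 420, (3.122) p. 420, (3.130) p. 421, Thm 3.11 p. 416, with [Balaban1985Variational] (45)–(46) p. 285,
# AT `k = n+1` AVERAGING LEVELS ON PRINT's DIAGONAL `ηL^{n+1} = 1`: **THE `(Q_kG̃_kQ_k*)⁻¹`-LETTER AND THE THREE ENERGY ROWS OF PRINT's `H̃_{1,k}(U) = G̃_kQ_k*(Q_kG̃_kQ_k*)⁻¹`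
# FOR ANY HESSIAN-SLOT PERTURBATION WITH `θ ≤ γ₁∕2` — CLOSED FORM: the chain's `K⁻¹`-letter `C_K` of the row OWNER's `B9Eq3126KFloorSlotDiagonal.exists_KFloor_slot_diagonal`
# INHABITED by this lineage's `B9Eq3126H1BoundTowerVariational`, the chain's positivity witness `hposU` DERIVED, `hRS` from UNITARITY; `∃ α₀ γ₁ C_K C_H` closed in
# `(d, a, L, M_φ, M_φ′, r, C_τ, ρ_w)` BEFORE EVERY BINDER** (the «Closed» storey of the row's layering: OWNER (letters displayed) → leaf-02 (letters inhabited))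

statement-level skeleton of published theorems with citation tags; proofs where landed; nothing here is a claim about the Yang–Mills mass gap

CITATION HEADER (lean-in-tree rule).  Audit cell `pub-balaban`, sub-cell `t4`, BINDER row NE9; filed by NE9 formalisation-swarm LEAF PROVER 02
(`b2b-balaban-t4-ne9-formalise-leaf-02`, gen 68) on the row OWNER t4-ne9-p1 g88's word W-5 (journal l.52637: OFFER O-ne9leaf02-g68-1 «WELCOME as the consumer-facing
closed letter … GO, yours»).  Sources READ in the held text layers: [Balaban1985BackgroundPropagators] (`paper:balaban1985-cmp99-background-propagators`, journal page =
PDF page + 388) p. 416 Thm 3.11, pp. 420–421 (3.122)–(3.130); [Balaban1985Variational] (`paper:balaban1985-cmp102-variational-background`, journal page = PDF page + 276)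
p. 285 (45)–(46) (via the tree's render-verified transcripts quoted in `B11Eq103H1Complex` ∕ `B9Eq3126GreenLettersVariational`).

THE PRINT (verbatim, text layer).  [B9] p. 420: *«To calculate the last integral we have to find a minimum of the functional … on configurations A satisfying
QA = B, and G̃⁻¹ defined as G̃⁻¹ = Δ_π + DRD* + Q*aQ. … H B = G̃Q*(QG̃Q*)⁻¹B. (3.126) We have obtained formally the same representation for the operator H as
in [3,4] (1.103), (2.35), but now the operator G̃ is much more complicated. It differs from the operator investigated in previous sections by the additional
term Δ′_π, but we will prove that this term is a small perturbation of Δ_a»*; p. 421: *«G̃ = G₀(I − Δ′_πG₀)⁻¹ (3.130)»*; p. 416, Thm 3.11: *«the operators Δ′_a, G′,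
(Q′G′²Q′*)⁻¹, Δ_a, G are positive definite»*.  [B11] p. 285: *«The operators Δ, Q and R define the operator H. Let us recall that it is an operator defined on
configurations B and giving a minimum of the quadratic form ½⟨A, ΔA⟩ under the restrictions L^jηQ_jA = B on Λ_j, j = 0, 1, …, k, RD*A = 0. Thus it has the
following properties L^jηQ_jHB = B on Λ_j, RD*HB = 0, (45) and the Theorem 3.12 from [5] implies |HB| ≤ B₀(L^jη)^{−1}|B| … (46)»*.

WHY THIS FILE (cell context).  The row OWNER's `B9Eq3126KFloorSlotDiagonal` (plan v8 «the K̃-floor transfer») moves the chain's `K⁻¹`-letter at `U` across a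
Hessian-slot change — print's `G₀ ↦ G̃` of (3.130), DIAGNOSIS D-ne9p1-g87-1 — variationally: the chain's minimiser `H⁰` is the comparison section, so
`‖(Q_kG̃_kQ_k*)⁻¹‖ ≤ (1 + θ∕γ₁)·C_K` and the energy rows of `H̃_{1,k}(U)` are `≤ √(3∕γ₁)·√C_K`, with `C_K` and the chain's positivity witness `hposU` DISPLAYED and
the class spelled with `hRS`.  This lineage owns the closed `C_K` (`B9Eq3126H1BoundTowerVariational.exists_norm_KinvLatticeK_H1LatticeK_le_diagonal_closed`: the bond-tent
`K`-floor by form perturbation, every letter discharged from the windows on the diagonal, spelled with UNITARITY + a `*`-trace).  THIS file is the two-line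
junction — the row's standing layering «OWNER (letters displayed) → leaf-02 `…Closed` (letters inhabited)» (cf. `B9Eq3126H1kLipschitzEnergyClosed`,
`B9Eq3153FrakGkLipschitzEnergyClosed`): `C_K` plugged BY NAME, `hposU` DERIVED from the chain's strong coercivity (`B9Eq3153FrakGkBoundDiagonal` §1 (i)), `hRS`
DERIVED from unitarity (`B9Eq310HessianHermitian.adTransportW_adjoint`), `1 + θ∕γ₁ ≤ 3∕2` absorbed — so a consumer of print's `(QG̃Q*)⁻¹` ∕ `H̃` letters at ANY
slot (print's `laplaceAkPi`, or a second background's slot in the two-background ladder) reads CLOSED numbers with no `K`-letter to thread.  An independent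
derivation of the same two letters by this seat (journal l.52491, twin `g68/stage/B9Eq3126KFloorSlotDiagonal.v1.staged.lean` 0157b3dabee6fb33, withdrawn as a
filing when the OWNER's INTENT-1 was announced first) served as the control of the X-read chair on the host.

WHAT IS PROVED (sorry-free; 0 `def`; [folklore] composition BY NAME of landed theorems + one threshold; nothing of [B9] ∕ [B11] asserted as printed).
**`exists_KFloor_slot_diagonal_closed`** — `∃ α₀ γ₁ C_K C_H > 0` (`γ₁` the host's; `C_K = (3∕2)·C_K⁰`, `C_H = C₁·√C_K⁰` with `C_K⁰` this lineage's closed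
diagonal `K`-letter and `C₁ = √(3∕γ₁)` the host's; `α₀` the `min` of the three suppliers' ceilings) such that for every `n` (`3 ≤ L^{n+1}`), `η` (`ηL^{n+1} = 1`),
`c₀, c₁` (`c₀(L^{n+1})^d = c₁`, `|η|^d∕c₀ ≤ ρ_w`), `m`, background `U` of E162's data, UNITARY (`U(b)* = U(b)⁻¹`), `U(b) ∈ U1`, in the three windows
`‖U(b) − 1‖ ≤ αη`, `‖U(∂p) − 1‖ ≤ αη²`, `‖Ū^j(b) − 1‖ ≤ ε_j ≤ αr^j` with `0 ≤ α ≤ α₀`, every slot `Δ₁` with `‖⟨u, Δ₁v⟩ − ⟨u, Δ^η(U)v⟩‖ ≤ θ·N₁(u)N₁(v)`,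
`0 ≤ θ ≤ γ₁∕2`, `Δ̃ = Δ₁ + D_UR_kD*_U + Q_k*aQ_k` symmetric, and ANY witnesses `hpos₁` (positivity of `Δ̃`), `hQ` (onto `Q_k(U)`):
`‖(Q_kG̃_kQ_k*)⁻¹c‖ ≤ C_K‖c‖` and `‖H̃b‖, ‖curl₁(H̃b)‖, ‖div₁(H̃b)‖ ≤ C_H‖b‖` for `H̃ = B11Eq103H1Complex.H1LatticeK hpos₁ hQ` — the `L²`∕energy shadow of
[B11] (46) for PRINT's `H` of (3.126) at the `k`-th step, closed numbers.
HONEST SCOPE.  Composition only: the estimate is the host's (and, through it, `B9Eq3126GreenLettersVariational` §3 ∕ `B9Eq3126H1LipschitzEnergy.weight_H1K_le`); the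
θ-letter and the symmetry of `Δ̃` stay HYPOTHESES (inhabited for `laplaceAkPi` by `B9Eq3120DeltaPiPrimeFormDiagonalClosed` and `laplaceAkPi_isSymmetric`, not here);
crude constants; no kernel bound, no decay ([B9] Thm 3.12∕3.13 untouched), NOT the (N)-reading; the small-field WINDOWS, E162's data, unitarity, the trace letters,
`ρ_w`, `1 ≤ d`, `3 ≤ L^{n+1}`, `hpos₁`, `hQ` stay HYPOTHESES.  NOT summit progress (cell pub-balaban: NE9 NOT PRINTED ∕ NOT PROVED; «NE9 ⇐ the named binders»; row
WALLED ON A MODEL (O-NE9-1; #5 UNRULED); spine PROVED 0∕9; rung (B)+1 finite T⁴ — NOT infinite volume, NOT mass gap, NOT BetaPertH, NOT Clay).  HONEST DEPENDENCY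
(cell line): continuum YM on T⁴ ⇐ BetaPertH ∧ nine spine estimates (0/9 proved); BetaPertH ⇐ (D1) ∧ (D4) ∧ CAP+tail; G-an2-4 gates asym, D1 and NE2/3/4.  NEW file
importing `B9Eq3126KFloorSlotDiagonal` (row OWNER t4-ne9-p1 g88) and `B9Eq3126H1BoundTowerVariational` (this lineage); nothing modified.  Net new unproved facts: 0.
-/

noncomputable section

open scoped InnerProductSpace ComplexConjugate BigOperators

namespace Literature.MathematicalPhysics.QuantumFieldTheory.Balaban1983to89.B9Eq3126KFloorSlotDiagonalClosed

open B4Sect5Torus (TSite)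
open B9SectCLatticeCarrier (Bond)
open B11Eq103H1Complex (BondL2K covDivL2K laplaceALatticeK H1LatticeK KinvLatticeK)
open B9Eq310HessianOperator (adTransportW hessOp covCurlL2K)
open B9Eq310HessianHermitian (adTransportW_adjoint)
open B9Eq310DeltaPrime (plaqHolU)
open B9Eq315QTorus (perCfg cornerSite)
open B9Eq315QTower (towerP UlevOf)
open B9Eq326OperatorTower (QkW RofUk laplaceAk)
open B7Prop1Explicit (U1 Wcx boxVec)
open B9Eq3153FrakGkBoundDiagonal (exists_energy_letters_diagonal_closed)
open B9Eq3126H1BoundTowerVariational (exists_norm_KinvLatticeK_H1LatticeK_le_diagonal_closed)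
open B9Eq3126KFloorSlotDiagonal (exists_KFloor_slot_diagonal)

variable {d : ℕ} (hd : 1 ≤ d) (L : ℕ) [NeZero L] (hL : 1 ≤ L)
  {𝔸 : Type*} [NormedRing 𝔸] [NormedAlgebra ℂ 𝔸] [CompleteSpace 𝔸] [NormOneClass 𝔸] [StarRing 𝔸] [NormedStarGroup 𝔸] [StarModule ℂ 𝔸]
  {W : Type*} [NormedAddCommGroup W] [InnerProductSpace ℂ W] [FiniteDimensional ℂ W] (φ : W ≃ₗ[ℂ] 𝔸)
  {Mφ Mφ' : ℝ} (hMφ : 0 ≤ Mφ) (hMφ' : 0 ≤ Mφ') (hφ : ∀ w, ‖φ w‖ ≤ Mφ * ‖w‖) (hφ' : ∀ X, ‖φ.symm X‖ ≤ Mφ' * ‖X‖)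
  {a : ℝ} (ha : 0 < a) {r : ℝ} (hr0 : 0 ≤ r) (hr1 : r < 1)
  (τ : 𝔸 →ₗ[ℂ] ℂ) {Cτ : ℝ} (hτ : ∀ X, ‖τ X‖ ≤ Cτ * ‖X‖) (hCτ : 0 ≤ Cτ) {ρw : ℝ} (hρw : 0 ≤ ρw)
  (hτ₁ : ∀ X : 𝔸, τ (star X) = conj (τ X)) (hτ₂ : ∀ X Y : 𝔸, τ (X * Y) = τ (Y * X))
  (hφτ : ∀ X Y : 𝔸, ⟪φ.symm X, φ.symm Y⟫_ℂ = τ (star X * Y))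

include hd hMφ hMφ' hφ hφ' ha hr0 hr1 hτ hCτ hρw hτ₁ hτ₂ hφτ

/-- **THE `(Q_kG̃_kQ_k*)⁻¹`-LETTER AND THE ROWS OF PRINT's `H̃_{1,k}(U)` FOR ANY HESSIAN-SLOT PERTURBATION ON THE DIAGONAL — CLOSED FORM, NO `K`-LETTER, NO
`hposU`, NO `hRS` DISPLAYED.**  There are `α₀, γ₁, C_K, C_H > 0` (`γ₁` the host's; `C_K = (3∕2)C_K⁰`, `C_H = C₁√C_K⁰`; all closed in `(d, a, L, M_φ, M_φ′, r, C_τ, ρ_w)`)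
such that for every `n` (`3 ≤ L^{n+1}`), `η` (`ηL^{n+1} = 1`), `c₀, c₁` (`c₀(L^{n+1})^d = c₁`, `|η|^d∕c₀ ≤ ρ_w`), `m`, every background `U` of E162's data which is
unitary, `U(b) ∈ U1`, in the windows `‖U(b) − 1‖ ≤ αη`, `‖U(∂p) − 1‖ ≤ αη²`, `‖Ū^j(b) − 1‖ ≤ ε_j ≤ αr^j` with `0 ≤ α ≤ α₀`, every slot `Δ₁` with
`‖⟨u, Δ₁v⟩ − ⟨u, Δ^η(U)v⟩‖ ≤ θ·N₁(u)N₁(v)`, `0 ≤ θ ≤ γ₁∕2`, `Δ̃ = Δ₁ + D_UR_kD*_U + Q_k*aQ_k` symmetric, and ANY witnesses `hpos₁`, `hQ`: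
`‖(Q_kG̃_kQ_k*)⁻¹c‖ ≤ C_K‖c‖` and `‖H̃b‖, ‖curl₁(H̃b)‖, ‖div₁(H̃b)‖ ≤ C_H‖b‖` — the row OWNER's `exists_KFloor_slot_diagonal` with `C_K` INHABITED by
`exists_norm_KinvLatticeK_H1LatticeK_le_diagonal_closed`, `hposU` from `exists_energy_letters_diagonal_closed` (i), `hRS` from `adTransportW_adjoint`, and
`(1 + θ∕γ₁)C_K⁰ ≤ (3∕2)C_K⁰`.  For `Δ₁ := π_k†Δ^η(U)π_k` (`B9Eq3119DeltaPiTower.laplaceAkPi` by `rfl`): [B11] (46)'s `L²` shadow for PRINT's `H` of (3.126) at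
the `k`-th step, modulo the θ-letter and the symmetry. [folklore]
[cite: Balaban1985BackgroundPropagators, (3.126) p.420, (3.122) p.420, (3.130) p.421, Thm 3.11 p.416; Balaban1985Variational, (45)–(46) p.285] -/
theorem exists_KFloor_slot_diagonal_closed :
    ∃ α₀ γ₁ CK CH : ℝ, 0 < α₀ ∧ 0 < γ₁ ∧ 0 < CK ∧ 0 < CH ∧ ∀ (n : ℕ) (η : ℝ), η * (L : ℝ) ^ (n + 1) = 1 → 3 ≤ L ^ (n + 1) →
      ∀ (c₀ c₁ : ℝ) [Fact (0 < c₀)] [Fact (0 < c₁)], c₀ * ((L : ℝ) ^ (n + 1)) ^ d = c₁ → |η| ^ d / c₀ ≤ ρw →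
      ∀ (m : Fin d → ℕ) [∀ i, NeZero (m i)] (U : Bond d (towerP L m (n + 1)) → 𝔸ˣ) (αU : ℕ → ℝ) (hα1 : ∀ j, αU j ≤ 1 / 64)
        (hU1 : ∀ (j : ℕ) (x : B7Prop1Explicit.Site d) (κ : Fin d), perCfg (towerP L m (j + 1)) (UlevOf L m (n + 1) U j) x κ ∈ U1 𝔸)
        (hreg : ∀ (j : ℕ) (y : TSite d (towerP L m j)) (κ : Fin d) (r : Fin d → Fin L),
          ‖((Wcx L (perCfg (towerP L m (j + 1)) (UlevOf L m (n + 1) U j)) (cornerSite L y) κ (boxVec L r) : 𝔸ˣ) : 𝔸) - 1‖ ≤ αU j)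
        (εU : ℕ → ℝ), (∀ j, 0 ≤ εU j) → (∀ (j : ℕ) (b : Bond d (towerP L m (j + 1))), ‖(UlevOf L m (n + 1) U j b : 𝔸) - 1‖ ≤ εU j) →
      ∀ {α : ℝ}, 0 ≤ α → α ≤ α₀ →
        (∀ b, star (U b : 𝔸) = (((U b)⁻¹ : 𝔸ˣ) : 𝔸)) →
        (∀ b, U b ∈ U1 𝔸) → (∀ b, ‖(U b : 𝔸) - 1‖ ≤ α * η) →
        (∀ p : B9SectCLatticeCarrier.Plaq d (towerP L m (n + 1)), ‖(plaqHolU U p : 𝔸) - 1‖ ≤ α * η ^ 2) →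
        (∀ j < n + 1, εU j ≤ α * r ^ j) →
        ∀ (Δ₁ : BondL2K ℂ d (towerP L m (n + 1)) c₀ W →ₗ[ℂ] BondL2K ℂ d (towerP L m (n + 1)) c₀ W) {θ : ℝ}, 0 ≤ θ → θ ≤ γ₁ / 2 →
        (∀ u v : BondL2K ℂ d (towerP L m (n + 1)) c₀ W, ‖⟪u, Δ₁ v⟫_ℂ - ⟪u, hessOp φ η U τ v⟫_ℂ‖ ≤
            θ * Real.sqrt (‖covCurlL2K ℂ c₀ ((η : ℂ))⁻¹ (adTransportW φ (fun _ : Bond d (towerP L m (n + 1)) => (1 : 𝔸ˣ))) u‖ ^ 2 +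
                  ‖covDivL2K ℂ c₀ ((η : ℂ))⁻¹ (adTransportW φ fun _ : Bond d (towerP L m (n + 1)) => (1 : 𝔸ˣ)⁻¹) u‖ ^ 2 + ‖u‖ ^ 2) *
                Real.sqrt (‖covCurlL2K ℂ c₀ ((η : ℂ))⁻¹ (adTransportW φ (fun _ : Bond d (towerP L m (n + 1)) => (1 : 𝔸ˣ))) v‖ ^ 2 +
                  ‖covDivL2K ℂ c₀ ((η : ℂ))⁻¹ (adTransportW φ fun _ : Bond d (towerP L m (n + 1)) => (1 : 𝔸ˣ)⁻¹) v‖ ^ 2 + ‖v‖ ^ 2)) →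
        (laplaceALatticeK ((η : ℂ))⁻¹ (adTransportW φ U) (adTransportW φ fun b => (U b)⁻¹) Δ₁ (RofUk L m n φ η U)
          (QkW L m n φ U hL αU hα1 hU1 hreg (c₀ := c₀) (c₁ := c₁)) a).IsSymmetric →
        ∀ (hpos₁ : ∀ x : BondL2K ℂ d (towerP L m (n + 1)) c₀ W, x ≠ 0 →
            0 < RCLike.re ⟪x, laplaceALatticeK ((η : ℂ))⁻¹ (adTransportW φ U) (adTransportW φ fun b => (U b)⁻¹) Δ₁ (RofUk L m n φ η U)
              (QkW L m n φ U hL αU hα1 hU1 hreg (c₀ := c₀) (c₁ := c₁)) a x⟫_ℂ)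
          (hQ : Function.Surjective (QkW L m n φ U hL αU hα1 hU1 hreg (c₀ := c₀) (c₁ := c₁))),
          (∀ c : BondL2K ℂ d m c₁ W, ‖KinvLatticeK hpos₁ hQ c‖ ≤ CK * ‖c‖) ∧
          ∀ b : BondL2K ℂ d m c₁ W,
            ‖H1LatticeK hpos₁ hQ b‖ ≤ CH * ‖b‖ ∧
            ‖covCurlL2K ℂ c₀ ((η : ℂ))⁻¹ (adTransportW φ (fun _ : Bond d (towerP L m (n + 1)) => (1 : 𝔸ˣ))) (H1LatticeK hpos₁ hQ b)‖ ≤ CH * ‖b‖ ∧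
            ‖covDivL2K ℂ c₀ ((η : ℂ))⁻¹ (adTransportW φ fun _ : Bond d (towerP L m (n + 1)) => (1 : 𝔸ˣ)⁻¹) (H1LatticeK hpos₁ hQ b)‖ ≤ CH * ‖b‖ := by
  -- the three suppliers, `∃`-first, BY NAME
  obtain ⟨α₁, CK₀, CH₀, hα₁, hCK₀, -, HK⟩ :=
    exists_norm_KinvLatticeK_H1LatticeK_le_diagonal_closed hd L hL φ hMφ hMφ' hφ hφ' ha hr0 hr1 τ hτ hCτ hρw hτ₁ hτ₂ hφτ
  obtain ⟨α₂, γE, hα₂, hγE, HE⟩ := exists_energy_letters_diagonal_closed (d := d) L hL φ hMφ hMφ' hφ hφ' ha hr0 hr1 τ hτ hCτ hρw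
  obtain ⟨α₃, γ₁, C1, hα₃, hγ₁, hC1, H1⟩ := exists_KFloor_slot_diagonal (d := d) L hL φ hMφ hMφ' hφ hφ' ha hr0 hr1 τ hτ hCτ hρw
  have hsCK : 0 < Real.sqrt CK₀ := Real.sqrt_pos.2 hCK₀
  refine ⟨min α₁ (min α₂ α₃), γ₁, 3 / 2 * CK₀, C1 * Real.sqrt CK₀, lt_min hα₁ (lt_min hα₂ hα₃), hγ₁, by positivity, mul_pos hC1 hsCK, ?_⟩
  intro n η hηL hL3 c₀ c₁ _ _ hw hρ m _ U αU hα1 hU1 hreg εU hεU hUε α hα0 hαle hUst hUb hUη hpl hεg Δ₁ θ hθ0 hθle hθ hsymm₁ hpos₁ hQ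
  have hαα₁ : α ≤ α₁ := hαle.trans (min_le_left _ _)
  have hαα₂ : α ≤ α₂ := hαle.trans ((min_le_right _ _).trans (min_le_left _ _))
  have hαα₃ : α ≤ α₃ := hαle.trans ((min_le_right _ _).trans (min_le_right _ _))
  -- `hRS` from unitarity + the trace letters
  have hRS : ∀ (b : Bond d (towerP L m (n + 1))) (v u : W), ⟪adTransportW φ U b v, u⟫_ℂ = ⟪v, adTransportW φ (fun b => (U b)⁻¹) b u⟫_ℂ :=
    adTransportW_adjoint φ τ hτ₂ hUst hφτ
  -- the chain's positivity at `U`, derived from the strong coercivity (not displayed)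
  have HEU := HE n η hηL c₀ c₁ hw hρ m U αU hα1 hU1 hreg εU hεU hUε hα0 hαα₂ hRS hUb hUη hpl hεg
  have hposU : ∀ x : BondL2K ℂ d (towerP L m (n + 1)) c₀ W, x ≠ 0 →
      0 < RCLike.re ⟪x, laplaceAk L m n φ η U hL αU hα1 hU1 hreg τ (c₀ := c₀) (c₁ := c₁) a x⟫_ℂ := fun x hx => by
    have h := (HEU x).1
    have hx' : 0 < ‖x‖ := norm_pos_iff.2 hx
    have h2 : 0 < γE * (‖covCurlL2K ℂ c₀ ((η : ℂ))⁻¹ (adTransportW φ (fun _ : Bond d (towerP L m (n + 1)) => (1 : 𝔸ˣ))) x‖ ^ 2 +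
        ‖covDivL2K ℂ c₀ ((η : ℂ))⁻¹ (adTransportW φ fun _ : Bond d (towerP L m (n + 1)) => (1 : 𝔸ˣ)⁻¹) x‖ ^ 2 + ‖x‖ ^ 2) :=
      mul_pos hγE (add_pos_of_nonneg_of_pos (add_nonneg (sq_nonneg _) (sq_nonneg _)) (pow_pos hx' 2))
    linarith
  -- the chain's `K`-letter at `U`, closed (this lineage)
  have hK := (HK n η hηL hL3 c₀ c₁ hw hρ m U αU hα1 hU1 hreg εU hεU hUε hα0 hαα₁ hUst hUb hUη hpl hεg hposU hQ).1
  -- the host: the transfer across the slot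
  have h1 := H1 n η hηL c₀ c₁ hw hρ m U αU hα1 hU1 hreg εU hεU hUε hα0 hαα₃ hRS hUb hUη hpl hεg Δ₁ hθ0 hθle hθ hsymm₁ hpos₁ hposU hQ hCK₀.le hK
  -- `(1 + θ∕γ₁)C_K⁰ ≤ (3∕2)C_K⁰`
  have hρle : (1 + θ / γ₁) * CK₀ ≤ 3 / 2 * CK₀ := by
    have hq : θ / γ₁ ≤ 1 / 2 := by rw [div_le_iff₀ hγ₁]; linarith
    exact mul_le_mul_of_nonneg_right (by linarith) hCK₀.le
  exact ⟨fun c => (h1.1 c).trans (mul_le_mul_of_nonneg_right hρle (norm_nonneg _)), fun b => h1.2 b⟩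

end Literature.MathematicalPhysics.QuantumFieldTheory.Balaban1983to89.B9Eq3126KFloorSlotDiagonalClosed

end
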